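import Mathlib
import HarnessLib
import Summits.ResolutionOfSingularities.ResolutionOfSingularities.Theorems.WildQuotientsWildQuotientResolutionS1aKillNecessity

/-!
# S1a — K-LEAST: THE KILL FILTRATION IS THE LEAST σ-ADMISSIBLE FILTRATION (abstract competitor)

[OURS · L1 W4.5c · lead-1 g10; plan-1 ASSIGNMENT v10.27 item (1), hand proof K-UNIQ v2 §A (`Cruxes/CyclicQuotientFourfolds/Lines/s1a-logminvertex-K-UNIQ-v2.md`),
SIG v2 §3 `Lines/W45cKUniqSig.lean`] — NOT statements of the manuscript; counted 0; AI-level work, weaker than expert review. Crux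
stmt-ResolutionOfSingularities-17941 `CyclicQuotientFourfolds`, line `s1a-logminvertex` v10, K-side (`stub_killTouchReachAux`). Route-independent; pure algebra.

Setting: `β ∈ B` a non-zero-divisor, `σ ∈ Aut B` with `σ^[p] = id`, a weighted centre `(f, w)` with shift `δ > 0` that is σ-ADMISSIBLE ((a′)_δ:
`y ∈ 𝒥ₙ ⇒ σ y − y ∈ β 𝒥ₙ₊δ`) and IRRELEVANT ((i)_δ: `vertexIdeal^N ≤ (aug σ_R : β s^δ) ⊔ (s)` in `R^w`). NO regularity is assumed on `f`. The COMPETITOR is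
here an ABSTRACT multiplicative filtration `F` of `B` which is σ-admissible with shift `δ'` ((a′)_δ' w.r.t. the same `β`), contains the centre (`f t ∈ F₁`) and has
REDUCED associated graded ring in the weak form GR-RED `0 < N → y^N ∈ F_{Nm+1} → y ∈ F_{m+1}`. (The SIG's competitor — the weighted filtration of a regular
sequence `f'` with `B ⧸ (f')` reduced — is an instance: GR-RED for it is weighted quasi-regularity, filed separately.)
* `filtration_pow_mem`, `filtration_prod_pow_mem`, `weightedFiltration_le_ceilDiv` — `fₜ ∈ F_{oₜ}`, `a·wₜ ≤ b·oₜ` ⇒ `𝒥ₘ(f,w) ≤ F_{⌈a m / b⌉}`;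
* `coeff_mem_toNat` — coefficients of elements of `R^w`;
* ★★★ `weightedFiltration_le_of_kill_of_filtration` — **K-LEAST**: `n·δ ≤ k·δ' ⇒ 𝒥ₖ(f,w) ≤ Fₙ`.
Proof (K-UNIQ v2 §A with integer bookkeeping): if every `fₜ ∈ F_{oₜ}` with `δ' wₜ ≤ δ oₜ` the claim is the monomial estimate. Otherwise pick a bad `t = i₀`
minimising `oₜ/wₜ` (`oₜ = ord_F fₜ`, finite for bad `t`), `o₀ = o_{i₀}`, `W = w_{i₀}`: then `δ o₀ < δ' W`, `fₜ ∈ F_o` with `o₀ wₜ ≤ W o` for ALL `t`, hence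
`𝒥ₘ ≤ F_{⌈o₀ m / W⌉}`; with `Qₘ := F_{⌈(o₀ m + 1)/W⌉} + 𝒥ₘ₊₁` the ideal `𝔔 = {u : uₐ ∈ β Q_{(a+δ)⁺}}` of `R^w` contains `aug σ_R` (by (a′)_δ, (a′)_δ', `β` nzd and
`δ' W ≥ δ o₀ + 1`), so `z ∈ (aug σ_R : β s^δ) ⇒ zₙ ∈ Qₙ`, and `(s)`-parts have `n`-th coefficient in `𝒥ₙ₊₁ ⊆ Qₙ`; reading the coefficient of `t^{NW}` in
`(f_{i₀} t^W)^N ∈ (aug : β s^δ) ⊔ (s)` gives `f_{i₀}^N ∈ Q_{NW} ⊆ F_{N o₀ + 1}`, so GR-RED gives `f_{i₀} ∈ F_{o₀+1}` — contradicting `o₀ = ord_F f_{i₀}`.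
-/

set_option linter.dupNamespace false

noncomputable section

open Literature.AlgebraicGeometry.Resolution
open scoped LaurentPolynomial
open LaurentPolynomial
open Summit.ResolutionOfSingularities.ResolutionOfSingularities.Theorems.WildQuotientResolution.S1.CoarseChart

namespace Summit.ResolutionOfSingularities.ResolutionOfSingularities.Theorems.WildQuotientResolution.S1.KillCert

universe u

variable {B : Type u} [CommRing B]

/-! ## Multiplicative filtrations: powers, monomials, ceilings -/

/-- `y ∈ Fₐ ⇒ yˡ ∈ F_{l a}`. [folklore] -/
theorem filtration_pow_mem (F : IdealFiltration B) {y : B} {a : ℕ} (hy : y ∈ F.ideal a) (l : ℕ) : y ^ l ∈ F.ideal (l * a) := by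
  induction l with
  | zero => rw [zero_mul, F.ideal_zero]; trivial
  | succ l ih =>
    have := F.mul_le _ _ (Ideal.mul_mem_mul ih hy)
    rwa [← pow_succ, show l * a + a = (l + 1) * a by ring] at this

/-- `gᵢ ∈ F_{oᵢ}` for all `i` ⇒ the monomial `g^α` lies in `F_{Σ αᵢ oᵢ}`. [folklore] -/
theorem filtration_prod_pow_mem (F : IdealFiltration B) {ι : Type*} (g : ι → B) (o : ι → ℕ) (hmem : ∀ i, g i ∈ F.ideal (o i))
    (α : ι →₀ ℕ) : (α.prod fun i e => g i ^ e) ∈ F.ideal (Finsupp.weight o α) := by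
  classical
  induction α using Finsupp.induction with
  | zero => rw [Finsupp.prod_zero_index, map_zero, F.ideal_zero]; trivial
  | single_add i k α hi hk ih =>
    rw [prod_pow_add, map_add, Finsupp.weight_single, smul_eq_mul, Finsupp.prod_single_index (h := fun i e => g i ^ e) (pow_zero _)]
    exact F.mul_le _ _ (Ideal.mul_mem_mul (filtration_pow_mem F (hmem i) k) ih)

/-- `q ≤ b ⌈q/b⌉`. [folklore] -/
theorem le_mul_ceilDiv {b : ℕ} (hb : 0 < b) (q : ℕ) : q ≤ b * (q ⌈/⌉ b) := (ceilDiv_le_iff_le_mul hb).mp le_rfl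

/-- `q ≤ b o ⇒ ⌈q/b⌉ ≤ o`. [folklore] -/
theorem ceilDiv_le_of_le_mul {b : ℕ} (hb : 0 < b) {q o : ℕ} (h : q ≤ b * o) : q ⌈/⌉ b ≤ o := (ceilDiv_le_iff_le_mul hb).mpr h

/-- `b o < q ⇒ o + 1 ≤ ⌈q/b⌉`. [folklore] -/
theorem succ_le_ceilDiv_of_mul_lt {b : ℕ} (hb : 0 < b) {q o : ℕ} (h : b * o < q) : o + 1 ≤ q ⌈/⌉ b := by
  by_contra h'
  push Not at h'
  exact absurd ((ceilDiv_le_iff_le_mul hb).mp (Nat.le_of_lt_succ h')) (not_le.mpr h)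

/-- `b n ≤ q ⇒ n ≤ ⌈q/b⌉`. [folklore] -/
theorem le_ceilDiv_of_mul_le {b : ℕ} (hb : 0 < b) {q n : ℕ} (h : b * n ≤ q) : n ≤ q ⌈/⌉ b := by
  rcases Nat.eq_zero_or_pos n with rfl | hn
  · exact Nat.zero_le _
  · have : b * (n - 1) < q := lt_of_lt_of_le (Nat.mul_lt_mul_of_pos_left (Nat.sub_lt hn Nat.one_pos) hb) h
    have := succ_le_ceilDiv_of_mul_lt hb this
    omega

/-- `⌈(q+q')/b⌉ ≤ ⌈q/b⌉ + ⌈q'/b⌉`. [folklore] -/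
theorem ceilDiv_add_le {b : ℕ} (hb : 0 < b) (q q' : ℕ) : (q + q') ⌈/⌉ b ≤ q ⌈/⌉ b + q' ⌈/⌉ b :=
  ceilDiv_le_of_le_mul hb (by have := le_mul_ceilDiv hb q; have := le_mul_ceilDiv hb q'; rw [mul_add]; exact Nat.add_le_add ‹_› ‹_›)

/-- ★ **THE MONOMIAL ESTIMATE**: if every `fₜ ∈ F_{oₜ}` with `a wₜ ≤ b oₜ` (`b > 0`), then `𝒥ₘ(f, w) ≤ F_{⌈a m / b⌉}`. [OURS · L1 W4.5c] -/
theorem weightedFiltration_le_ceilDiv (F : IdealFiltration B) {c : ℕ} (f : Fin c → B) (w : Fin c → ℕ) {a b : ℕ} (hb : 0 < b)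
    (o : Fin c → ℕ) (ho : ∀ t, f t ∈ F.ideal (o t)) (how : ∀ t, a * w t ≤ b * o t) (m : ℕ) :
    (weightedFiltration f w).ideal m ≤ F.ideal ((a * m) ⌈/⌉ b) := by
  rw [weightedFiltration_ideal, Ideal.span_le]
  rintro _ ⟨α, hα, rfl⟩
  refine F.antitone (ceilDiv_le_of_le_mul hb ?_) (filtration_prod_pow_mem F f o ho α)
  have h1 : a * Finsupp.weight w α ≤ b * Finsupp.weight o α := by
    simp only [Finsupp.weight_apply, Finsupp.sum, Finset.mul_sum]
    exact Finset.sum_le_sum fun i _ => by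
      rw [smul_eq_mul, smul_eq_mul, mul_left_comm a (α i) (w i), mul_left_comm b (α i) (o i)]
      exact Nat.mul_le_mul_left _ (how i)
  exact (Nat.mul_le_mul_left a hα).trans h1

/-! ## Coefficient conditions on `R^w` -/

section Cobordant

variable {c : ℕ} (f : Fin c → B) (w : Fin c → ℕ)

/-- The coefficient of `tᵃ` (`a ∈ ℤ`) of an element of `R^w` lies in `𝒥_{a⁺}`. [folklore] -/
theorem coeff_mem_toNat (q : ↥(cobordantAlgebra f w)) (a : ℤ) : (q : B[T;T⁻¹]).coeff a ∈ (weightedFiltration f w).ideal a.toNat := by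
  rcases le_or_gt 0 a with ha | ha
  · have := coeff_mem_of_mem f w q a.toNat
    rwa [Int.toNat_of_nonneg ha] at this
  · rw [Int.toNat_eq_zero.mpr ha.le, (weightedFiltration f w).ideal_zero]; trivial

/-- `(x + y)⁺ ≤ x⁺ + y⁺` on `ℤ`. [folklore] -/
theorem toNat_add_le (x y : ℤ) : (x + y).toNat ≤ x.toNat + y.toNat := by omega

end Cobordant

/-! ## K-LEAST -/

variable {c : ℕ} (f : Fin c → B) (w : Fin c → ℕ) (σ : B ≃+* B)
  (hσJ : ∀ n : ℕ, ((weightedFiltration f w).ideal n).map (σ : B →+* B) ≤ (weightedFiltration f w).ideal n)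
  {p : ℕ} (hp : 0 < p) (hσp : ∀ x : B, (⇑σ)^[p] x = x)

/-- ★★★ **K-LEAST — THE KILL FILTRATION IS THE LEAST σ-ADMISSIBLE FILTRATION** (abstract competitor). Let `β` be a non-zero-divisor, `(f, w, δ)`
(`δ > 0`) a σ-admissible ((a′)_δ) weighted centre with IRRELEVANT shifted initial ideal ((i)_δ), and `F` any multiplicative filtration of `B` with
reduced associated graded ring (GR-RED: `0 < N → y^N ∈ F_{Nm+1} → y ∈ F_{m+1}`), containing the centre (`fₜ ∈ F₁`) and σ-admissible with shift `δ'`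
((a′)_δ' w.r.t. `β`). Then `n·δ ≤ k·δ' ⇒ 𝒥ₖ(f, w) ≤ Fₙ`: the normalised kill filtration is BELOW every competitor. No regularity is assumed on `f`.
[OURS · L1 W4.5c · K-UNIQ v2 §A; NOT a statement of the manuscript] -/
theorem weightedFiltration_le_of_kill_of_filtration (β : B) (hβ : β ∈ nonZeroDivisors B) (δ δ' : ℕ) (hδ : 0 < δ)
    (hadm : ∀ (n : ℕ) (y : B), y ∈ (weightedFiltration f w).ideal n →
      σ y - y ∈ Ideal.span {β} * (weightedFiltration f w).ideal (n + δ))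
    (hirr : ∃ N : ℕ, cobordantAlgebra.vertexIdeal f w ^ N ≤
      (augmentationIdeal (sigmaR σ f w hσJ hp hσp)).colon
          (Ideal.span {algebraMap B (↥(cobordantAlgebra f w)) β * cobordantAlgebra.s f w ^ δ}) ⊔
        cobordantAlgebra.excIdeal f w)
    (F : IdealFiltration B) (hred : ∀ (y : B) (N m : ℕ), 0 < N → y ^ N ∈ F.ideal (N * m + 1) → y ∈ F.ideal (m + 1))
    (hfF : ∀ t, f t ∈ F.ideal 1)
    (hadmF : ∀ (n : ℕ) (y : B), y ∈ F.ideal n → σ y - y ∈ Ideal.span {β} * F.ideal (n + δ'))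
    (n k : ℕ) (hnk : n * δ ≤ k * δ') :
    (weightedFiltration f w).ideal k ≤ F.ideal n := by
  classical
  by_cases hgood : ∀ t, ∃ o, f t ∈ F.ideal o ∧ δ' * w t ≤ δ * o
  · -- the monomial estimate
    choose o ho how using hgood
    refine (weightedFiltration_le_ceilDiv F f w hδ o ho how k).trans (F.antitone (le_ceilDiv_of_mul_le hδ ?_))
    simpa only [mul_comm] using hnk
  exfalso
  push Not at hgood
  -- bad indices and their `F`-orders
  let bad : Fin c → Prop := fun t => ∀ o, f t ∈ F.ideal o → δ * o < δ' * w t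
  obtain ⟨t₀, ht₀⟩ : ∃ t, bad t := hgood
  let ot : Fin c → ℕ := fun t => Nat.findGreatest (fun o => f t ∈ F.ideal o) (δ' * w t)
  have hot : ∀ t, f t ∈ F.ideal (ot t) := fun t =>
    Nat.findGreatest_spec (P := fun o => f t ∈ F.ideal o) (Nat.zero_le _) (by rw [F.ideal_zero]; trivial)
  have hwpos : ∀ t, bad t → 0 < w t := fun t ht => by
    have h0 := ht 0 (by rw [F.ideal_zero]; trivial)
    refine Nat.pos_of_ne_zero fun h => ?_
    rw [h, mul_zero, mul_zero] at h0
    exact lt_irrefl 0 h0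
  have hotmax : ∀ t, bad t → f t ∉ F.ideal (ot t + 1) := fun t ht hmem => by
    have hlt := ht _ hmem
    have hle : ot t + 1 ≤ δ' * w t := by nlinarith
    have := Nat.le_findGreatest (P := fun o => f t ∈ F.ideal o) hle hmem
    change ot t + 1 ≤ ot t at this
    omega
  -- the bad index with the least ratio `oₜ / wₜ`
  let S : Finset (Fin c) := Finset.univ.filter fun t => bad t
  obtain ⟨i₀, hi₀S, hmin⟩ := S.exists_min_image (fun t => (ot t : ℚ) / w t) ⟨t₀, by simp [S, ht₀]⟩
  have hbad₀ : bad i₀ := by simpa [S] using hi₀S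
  set o₀ : ℕ := ot i₀ with ho₀def
  set W : ℕ := w i₀ with hWdef
  have hW : 0 < W := hwpos i₀ hbad₀
  have hB0a : f i₀ ∈ F.ideal o₀ := hot i₀
  have hB0b : f i₀ ∉ F.ideal (o₀ + 1) := hotmax i₀ hbad₀
  have hB0c : δ * o₀ < δ' * W := hbad₀ o₀ hB0a
  have ho₀ : 1 ≤ o₀ := Nat.le_findGreatest (P := fun o => f i₀ ∈ F.ideal o) (by nlinarith) (hfF i₀)
  -- (M'): every `fₜ` has an `F`-order `o` with `o₀ wₜ ≤ W o`
  have hM : ∀ t, ∃ o, f t ∈ F.ideal o ∧ o₀ * w t ≤ W * o := by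
    intro t
    by_cases ht : bad t
    · refine ⟨ot t, hot t, ?_⟩
      have hq := hmin t (by simp [S, ht])
      rw [div_le_div_iff₀ (by exact_mod_cast hW) (by exact_mod_cast hwpos t ht)] at hq
      rw [mul_comm W]
      exact_mod_cast hq
    · obtain ⟨o, hmem, hwo⟩ : ∃ o, f t ∈ F.ideal o ∧ δ' * w t ≤ δ * o := by
        by_contra hcon
        push Not at hcon
        exact ht hcon
      refine ⟨o, hmem, Nat.le_of_mul_le_mul_left ?_ hδ⟩
      have h1 : δ * o₀ * w t ≤ δ' * W * w t := Nat.mul_le_mul_right _ hB0c.le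
      have h2 : W * (δ' * w t) ≤ W * (δ * o) := Nat.mul_le_mul_left _ hwo
      calc δ * (o₀ * w t) = δ * o₀ * w t := by ring
        _ ≤ δ' * W * w t := h1
        _ = W * (δ' * w t) := by ring
        _ ≤ W * (δ * o) := h2
        _ = δ * (W * o) := by ring
  -- Step 1: `𝒥ₘ ≤ F_{⌈o₀ m / W⌉}`
  have hStep1 : ∀ m, (weightedFiltration f w).ideal m ≤ F.ideal ((o₀ * m) ⌈/⌉ W) := by
    choose o ho how using hM
    exact weightedFiltration_le_ceilDiv F f w hW o ho how
  -- the family `Q`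
  let Q : ℕ → Ideal B := fun m => F.ideal ((o₀ * m + 1) ⌈/⌉ W) ⊔ (weightedFiltration f w).ideal (m + 1)
  have hQanti : Antitone Q := fun m m' hmm' =>
    sup_le_sup (F.antitone ((gc_mul_ceilDiv hW).monotone_l (by nlinarith))) ((weightedFiltration f w).antitone (by omega))
  have hJQ : ∀ a m, (weightedFiltration f w).ideal a * Q m ≤ Q (a + m) := by
    intro a m
    change _ * (_ ⊔ _) ≤ _ ⊔ _
    rw [Ideal.mul_sup]
    refine sup_le_sup ?_ ?_
    · refine (Ideal.mul_mono_left (hStep1 a)).trans ((F.mul_le _ _).trans (F.antitone ?_))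
      rw [show o₀ * (a + m) + 1 = o₀ * a + (o₀ * m + 1) by ring]
      exact ceilDiv_add_le hW _ _
    · exact (weightedFiltration f w).mul_le a (m + 1)
  have hQle : ∀ N', Q (N' * W) ≤ F.ideal (N' * o₀ + 1) := by
    intro N'
    refine sup_le (F.antitone (succ_le_ceilDiv_of_mul_lt hW (Nat.lt_succ_of_le (le_of_eq (by ring))))) ?_
    refine (hStep1 _).trans (F.antitone (succ_le_ceilDiv_of_mul_lt hW ?_))
    calc W * (N' * o₀) < W * (N' * o₀) + o₀ := Nat.lt_add_of_pos_right ho₀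
      _ = o₀ * (N' * W + 1) := by ring
  -- the ideal `𝔔 = {u ∈ R^w : uₐ ∈ β Q_{(a+δ)⁺}}` of `R^w` and `aug σ_R ≤ 𝔔`
  let 𝔔 : Ideal ↥(cobordantAlgebra f w) :=
    { carrier := {u | ∀ a : ℤ, (u : B[T;T⁻¹]).coeff a ∈ Ideal.span {β} * Q (a + δ).toNat}
      add_mem' := fun {u v} hu hv a => by
        rw [AddMemClass.coe_add, AddMonoidAlgebra.coeff_add, Finsupp.add_apply]
        exact Ideal.add_mem _ (hu a) (hv a)
      zero_mem' := fun a => by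
        rw [ZeroMemClass.coe_zero, AddMonoidAlgebra.coeff_zero, Finsupp.zero_apply]
        exact Ideal.zero_mem _
      smul_mem' := fun r u hu a => by
        rw [smul_eq_mul, MulMemClass.coe_mul, AddMonoidAlgebra.coeff_mul_apply_left, Finsupp.sum]
        refine Ideal.sum_mem _ fun h _ => ?_
        obtain ⟨q, hq, e⟩ := Ideal.mem_span_singleton_mul.mp (hu (-h + a))
        rw [← e, mul_left_comm]
        refine Ideal.mul_mem_mul (Ideal.mem_span_singleton_self β) ?_
        refine hQanti ?_ (hJQ _ _ (Ideal.mul_mem_mul (coeff_mem_toNat f w r h) hq))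
        have := toNat_add_le h (-h + a + δ)
        rwa [show h + (-h + a + (δ : ℤ)) = a + δ by ring] at this }
  have hmem𝔔 : ∀ u : ↥(cobordantAlgebra f w), u ∈ 𝔔 ↔ ∀ a : ℤ, (u : B[T;T⁻¹]).coeff a ∈ Ideal.span {β} * Q (a + δ).toNat :=
    fun u => Iff.rfl
  have haug : augmentationIdeal (sigmaR σ f w hσJ hp hσp) ≤ 𝔔 := by
    rw [augmentationIdeal, Ideal.span_le]
    rintro _ ⟨z, rfl⟩
    rw [SetLike.mem_coe, hmem𝔔]
    intro a
    rw [AddSubgroupClass.coe_sub, coe_sigmaR, AddMonoidAlgebra.coeff_sub, Finsupp.sub_apply, coeff_sigmaT]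
    have hz : (z : B[T;T⁻¹]).coeff a ∈ (weightedFiltration f w).ideal a.toNat := coeff_mem_toNat f w z a
    obtain ⟨θ, hθ, e1⟩ := Ideal.mem_span_singleton_mul.mp (hadm _ _ hz)
    obtain ⟨θ', hθ', e2⟩ := Ideal.mem_span_singleton_mul.mp (hadmF _ _ (hStep1 _ hz))
    have hθθ' : θ' = θ := (mul_cancel_left_mem_nonZeroDivisors hβ).mp (e2.trans e1.symm)
    rw [← e1]
    refine Ideal.mul_mem_mul (Ideal.mem_span_singleton_self β) (hQanti (toNat_add_le a δ) ?_)
    rw [Int.toNat_natCast]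
    refine Ideal.mem_sup_left (F.antitone (ceilDiv_le_of_le_mul hW ?_) (hθθ' ▸ hθ'))
    have h1 := le_mul_ceilDiv hW (o₀ * a.toNat)
    have h2 : δ * o₀ + 1 ≤ δ' * W := hB0c
    nlinarith
  -- read the coefficient of `t^{NW}` in `(f_{i₀} t^W)^N ∈ (aug : β s^δ) ⊔ (s)`
  obtain ⟨N, hN⟩ := hirr
  have hu := hN (Ideal.pow_mem_pow (cobordantAlgebra.u'_mem_vertexIdeal f w i₀) N)
  obtain ⟨z, hz, z', hz', hsum⟩ := Submodule.mem_sup.mp hu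
  have hcoefU : ((cobordantAlgebra.u' f w i₀ ^ N : ↥(cobordantAlgebra f w)) : B[T;T⁻¹]).coeff ((N * W : ℕ) : ℤ) = f i₀ ^ N := by
    rw [SubmonoidClass.coe_pow, cobordantAlgebra.coe_u', mul_pow, ← map_pow, T_pow, ← single_eq_C_mul_T,
      show ((N * W : ℕ) : ℤ) = (N : ℤ) * (w i₀ : ℕ) by rw [hWdef]; push_cast; ring, AddMonoidAlgebra.coeff_single, Finsupp.single_eq_same]
  have hzg : ∀ a : ℤ, ((z * (algebraMap B (↥(cobordantAlgebra f w)) β * cobordantAlgebra.s f w ^ δ) : ↥(cobordantAlgebra f w)) : B[T;T⁻¹]).coeff a ∈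
      Ideal.span {β} * Q (a + δ).toNat :=
    (hmem𝔔 _).mp (haug (Ideal.mem_colon_span_singleton.mp hz))
  have hzn : ∀ m : ℕ, (z : B[T;T⁻¹]).coeff (m : ℤ) ∈ Q m := by
    intro m
    have h1 := hzg ((m : ℤ) + -(δ : ℤ))
    rw [MulMemClass.coe_mul, MulMemClass.coe_mul, cobordantAlgebra.coe_algebraMap, cobordantAlgebra.coe_s_pow, ← single_eq_C_mul_T,
      AddMonoidAlgebra.coeff_mul_single_add, show ((m : ℤ) + -(δ : ℤ) + δ).toNat = m by omega] at h1
    obtain ⟨q, hq, e⟩ := Ideal.mem_span_singleton_mul.mp h1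
    have e' : q = (z : B[T;T⁻¹]).coeff (m : ℤ) := (mul_cancel_right_mem_nonZeroDivisors hβ).mp (by rw [mul_comm q β]; exact e)
    exact e' ▸ hq
  have hz'n : ∀ m : ℕ, (z' : B[T;T⁻¹]).coeff (m : ℤ) ∈ (weightedFiltration f w).ideal (m + 1) := by
    intro m
    have hz'' : z' ∈ Ideal.span {cobordantAlgebra.s f w} := hz'
    obtain ⟨r, hr⟩ := Ideal.mem_span_singleton'.mp hz''
    rw [← hr, MulMemClass.coe_mul, cobordantAlgebra.coe_s, show (T (-1) : B[T;T⁻¹]) = C 1 * T (-1) by rw [map_one, one_mul],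
      ← single_eq_C_mul_T, show (m : ℤ) = ((m + 1 : ℕ) : ℤ) + (-1) by push_cast; ring, AddMonoidAlgebra.coeff_mul_single_add, mul_one]
    exact coeff_mem_of_mem f w r (m + 1)
  have hfN : f i₀ ^ N ∈ F.ideal (N * o₀ + 1) := by
    have e : ((z + z' : ↥(cobordantAlgebra f w)) : B[T;T⁻¹]).coeff ((N * W : ℕ) : ℤ) =
        ((cobordantAlgebra.u' f w i₀ ^ N : ↥(cobordantAlgebra f w)) : B[T;T⁻¹]).coeff ((N * W : ℕ) : ℤ) := by rw [hsum]
    rw [AddMemClass.coe_add, AddMonoidAlgebra.coeff_add, Finsupp.add_apply, hcoefU] at e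
    rw [← e]
    exact Ideal.add_mem _ (hQle N (hzn (N * W))) (hQle N (Ideal.mem_sup_right (hz'n (N * W))))
  -- GR-RED contradicts the maximality of `o₀`
  rcases Nat.eq_zero_or_pos N with hN0 | hNpos
  · rw [hN0, pow_zero, zero_mul, zero_add] at hfN
    apply hB0b
    have h1 : (1 : B) ^ (o₀ + 1) ∈ F.ideal ((o₀ + 1) * 1) := filtration_pow_mem F hfN (o₀ + 1)
    rw [one_pow, mul_one] at h1
    have htop : F.ideal (o₀ + 1) = ⊤ := (Ideal.eq_top_iff_one _).mpr h1
    rw [htop]; trivial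
  · exact hB0b (hred (f i₀) N o₀ hNpos hfN)

end Summit.ResolutionOfSingularities.ResolutionOfSingularities.Theorems.WildQuotientResolution.S1.KillCert

end
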